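import Literature.NumberTheory.EllipticCurves.HeightDensityFullBSDOffSm
import HarnessLib

/-!
# The full BSD formula off `S_ss(E)` in analytic rank `0` for a proportion `≥ c⁰` of elliptic curves over `ℚ` by height
# (row (ii-3a) of `PERCENT-FULL.md`, typed)

Companion of `HeightDensityFullBSDOffS.lean` / `HeightDensityFullBSDOffSSieve.lean` (row (ii-1)) and
`HeightDensityFullBSDOffSm.lean` (row (ii-2)) of the `pub-bsdpct` cell's `PERCENT-FULL.md`. Those rows
transfer the RANK PART of BSD in analytic rank `≤ 1` to Miller's `BSD(E,p)` at every prime `p ≥ 5`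
outside a curve-dependent set containing two FINITE exceptional sets, `Z*(E)` (W. Zhang's hypothesis
(2), rank `1`) and `M*(E)` (Skinner–Zhang's hypothesis (b), rank `1`). Both exceptional sets come from
the RANK-ONE theorems. Row (ii-3a) is the RANK-ZERO sub-statement, where no exceptional set is needed:

  `S_ss(E) := {2, 3} ∪ {p : E additive at p} ∪ {p : E good supersingular at p}`,

and the row asserts: at least a proportion `c⁰` of the curves `E_{A,B}` (naive height, lower density)
have `ord_{s=1} L(E,s) = 0` (hence `L(E,1) ≠ 0`), `rk E(ℚ) = 0`, `Ш(E/ℚ)` finite, AND `BSD(E,p)` at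
EVERY prime `p ≥ 5` of good ordinary or multiplicative reduction (`FullBSDOffSsPrime`) — `Z*(E)` and
`M*(E)` NOT excepted.

The one `p`-adic input is C. Skinner, *Multiplicative reduction and the cyclotomic main conjecture
for `GL₂`*, Pacific J. Math. 283 (2016) 171–200, Thm. C (PUBLISHED; tree fact
`Skinner2016_padicValRat_bsd_rank_zero`, which transcribes the printed range "good ordinary or
multiplicative reduction at a prime `p ≥ 3`"): "(i) `E[p]` is irreducible; (ii) there exists a prime
`q ≠ p` at which `E` has multiplicative reduction and `E[p]` is ramified. If `L(E,1) ≠ 0` then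
`|L(E,1)/Ω_E|_p^{-1} = |#Ш(E)∏_ℓ c_ℓ(E)|_p^{-1}`." At a good ordinary `p` this is the rank-`0` half
of Skinner–Urban 2014 Thm. 2 (the tree's bsd.S30 `padicValRat_bsd_rank_zero`, which asks for
SURJECTIVE `ρ̄_{E,p}`); Thm. C as vendored covers both reduction types under IRREDUCIBILITY, so bsd.S30
is not a binder of this file (`PERCENT-FULL.md` row (ii-3a) lists [SU14] Thm. 2 (a) at the good
ordinary primes and [Sk16] Thm. C at the multiplicative ones; either bookkeeping is served by the
theorems below, since surjectivity (F1) implies irreducibility). (i) comes from (F1) Duke 1997 Thm. 1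
(`Duke1997_exceptionalPrimes_densityZero` → `heightDensityGE_forall_surj_of_duke`), (ii) from (F3) the
kernel two-exact-primes sieve (`heightDensityGE_twoOrdOnePrimes_one`: two primes `ℓ₁ ≠ ℓ₂`, `ℓᵢ ≥ 5`,
`ord_{ℓᵢ}(4A³ + 27B²) = 1`, so `v_{ℓᵢ}(Δ_min) = 1` by (T) and `E[p]` is ramified at `ℓᵢ` for EVERY
`p`; one of them is `≠ p`); `L(E,1) ≠ 0` from `r_an = 0` and modularity (`hasEntireLFunction_rat`);
`rk E(ℚ) = 0` and `Ш` finite from Gross–Zagier–Kolyvagin (`rank_eq_analyticRank_of_analyticRank_le_one`);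
the print shape is turned into `BSDp` by the cell's bridge `Rank1Residual.bsdp_of_padicVal_printShape_rankZero`.

The rank-`0` density input enters as the HYPOTHESIS `hA0 : HeightDensityGE AnalyticRankZero c` — for
the cell's row, `c = c⁰ = 17190625/104166656 = 0.165030…`, which is the printed constant of
Bhargava–Skinner–Zhang, arXiv:1407.1826, Cor. 22 ("When ordered by height, at least `16.50%` of
elliptic curves over `ℚ` have both algebraic and analytic rank `0`"; proof: "a lower density of greater
than `3/8 × .5501 × .8 = .16503`") times the family normaliser `c₅ = (1 − 5⁻¹⁰)⁻¹` of the cell's audited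
densities (`(3/8)·(5501/10000)·(4/5)·c₅`; certified by two engines and referee A of the cell, R146.3).
Its inputs (the Bhargava–Shankar `5`-Selmer average, arXiv:1312.7859, a preprint; root-number
equidistribution; Skinner–Urban's converse at `p = 5`) are NOT in this tree, so no constant is proved
here: the file proves that the (ii-3a) proportion equals whatever analytic-rank-`0` proportion is
supplied, exactly as rows (ii-1)/(ii-2) do for the rank part.

PROVED here (no `sorry`, standard axioms; NO named fact, NO closed `Prop` — the only definitions are
the predicates `AnalyticRankZero` and `FullBSDOffSsPrime` on pairs `(A, B)`): the per-pair glue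
`bsdp_rankZero_of_Skinner2016` (stated at the vendored range `p ≥ 3`), the transfer theorem
`HeightDensityGE.analyticRankZero_and_fullBSDOffSsPrime_of_sieve` (every `c`), its instance at `c⁰`,
and the same proportion in the predicates of rows (ii-1)/(ii-2) (`FullBSDOffSsPrime → FullBSDOffSgoPrime ∧
FullBSDOffSmPrime`, i.e. `S_ss(E) ⊆ S_go′(E)` and `S_ss(E) ⊆ S_m′(E)`: the rank-`0` row excepts fewer primes
than rows (ii-1)/(ii-2); the two nestings are private plumbing). The row keeps
`3 ∈ S_ss(E)` (`5 ≤ p` in `FullBSDOffSsPrime`), as certified in the cell; the glue itself is available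
at `p = 3`.

## References

* C. Skinner, Pacific J. Math. 283 (2016) 171–200, Thm. C (p. 173). [cite: Skinner2016PacificMC, Thm. C]
* C. Skinner, E. Urban, Invent. Math. 195 (2014) 1–277, Thm. 2 (a). [cite: SkinnerUrban2014, Thm. 2 (a)]
* M. Bhargava, C. Skinner, W. Zhang, arXiv:1407.1826 (2014), Cor. 22 (p. 10) and Lemma 20 (proof).
  [cite: BhargavaSkinnerZhang2014, Cor. 22]
* M. Bhargava, A. Shankar, arXiv:1312.7859 (2013), Thm. 31 (the `5`-Selmer average) — an input of
  `c⁰`, not of this file. [cite: BhargavaShankar5Selmer2013, Thm. 31]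
* W. Duke, C. R. Acad. Sci. Paris 325 (1997) 813–818, Thm. 1. [cite: Duke1997, Thm. 1 (p. 815)]
* R. L. Miller, LMS J. Comput. Math. 14 (2011), Def. 1.1 (`BSDp`). [cite: Miller2011LMS, Def. 1.1]
-/

noncomputable section

open scoped Classical
open WeierstrassCurve Filter Topology Literature.NumberTheory.EllipticCurves

namespace Literature.NumberTheory.EllipticCurves

/-! ### The rank-`0` input property and the property "full BSD off `S_ss(E)`" -/

/-- **Analytic rank `0` in the height family**: `(A, B)` is in the family (`4A³ + 27B² ≠ 0`, no prime
`q` with `q⁴ ∣ A`, `q⁶ ∣ B`) and `ord_{s=1} L(E_{A,B}, s) = 0`. The lower-density statement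
`HeightDensityGE AnalyticRankZero 0.1650` is the conclusion of Bhargava–Skinner–Zhang, Cor. 22 ("at
least `16.50%` of elliptic curves over `ℚ` have both algebraic and analytic rank `0`"); it is used below
only as a HYPOTHESIS (`hA0`), at any constant. A predicate (no claim).
[cite: BhargavaSkinnerZhang2014, Cor. 22 (p. 10)] -/
def AnalyticRankZero (AB : ℤ × ℤ) : Prop :=
  IsInHeightFamily AB ∧ (shortWeierstrass AB).analyticRank = 0

/-- **The full BSD formula off `S_ss(E) = {2, 3} ∪ {additive p} ∪ {good supersingular p}`** for the
curve `E_{A,B}`: for every globally minimal model `W = C • E_{A,B}` and every prime `p ≥ 5` at which `W`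
has good ordinary reduction (`Rank1Residual.GoodOrd`: good reduction and `p ∤ a_p`) OR multiplicative
reduction, Miller's `BSD(E,p)` holds (`BSDp W p`). No exceptional set: neither `Z*(E)` (row (ii-1)) nor
`M*(E)` (row (ii-2)) is excepted. Row (ii-3a) of `PERCENT-FULL.md` (rank `0` only).
[cite: Miller2011LMS, Def. 1.1 (arXiv:1010.2431 p. 3)] -/
def FullBSDOffSsPrime (AB : ℤ × ℤ) : Prop :=
  ∀ (W : WeierstrassCurve ℚ) [W.IsElliptic] [W.IsGloballyMinimal] (C : VariableChange ℚ),
    C • shortWeierstrass AB = W → ∀ (p : ℕ) [Fact p.Prime], 5 ≤ p →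
      (Rank1Residual.GoodOrd W p ∨ W.HasMultiplicativeReductionAtPrime p) → BSDp W p

/-- `S_ss(E) ⊆ S_go′(E)`: full BSD off `S_ss(E)` implies full BSD off `S_go′(E)` (row (ii-1)'s
predicate `FullBSDOffSgoPrime`, which excepts `Z*(E)` in addition). Private plumbing for the last
theorem of the file. [folklore] -/
private theorem FullBSDOffSsPrime.fullBSDOffSgoPrime {AB : ℤ × ℤ} (h : FullBSDOffSsPrime AB) :
    FullBSDOffSgoPrime AB :=
  fun W _ _ C hW p _ hp hgo _ ↦ h W C hW p hp (Or.inl hgo)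

/-- `S_ss(E) ⊆ S_m′(E)`: full BSD off `S_ss(E)` implies full BSD at the multiplicative primes off
`M*(E) ∪ Z*(E)` (row (ii-2)'s predicate `FullBSDOffSmPrime`). Private plumbing for the last theorem
of the file. [folklore] -/
private theorem FullBSDOffSsPrime.fullBSDOffSmPrime {AB : ℤ × ℤ} (h : FullBSDOffSsPrime AB) :
    FullBSDOffSmPrime AB :=
  fun W _ _ C hW p _ hp hmult _ _ ↦ h W C hW p hp (Or.inr hmult)

/-! ### The per-pair glue in analytic rank `0` (Skinner 2016, Thm. C) -/

/-- **`BSD(E,p)` in analytic rank `0` at a good ordinary or multiplicative prime `p ≥ 3`** (Skinner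
2016 Thm. C, tree fact `Skinner2016_padicValRat_bsd_rank_zero`, at its vendored range `p ≥ 3`): if
`E[p]` is irreducible, some multiplicative prime `q ≠ p` has `p ∤ v_q(Δ_min)` (`E[p]` ramified at `q`),
and `ord_{s=1} L(E,s) = 0`, then Miller's `BSD(E,p)` holds — `L(E,1) = L^{(0)}(E,1) ≠ 0` by modularity
(`leadingLCoeff_ne_zero_holds`), `Ш` finite by Gross–Zagier–Kolyvagin, and the print shape (no torsion
term) is bridged by `Rank1Residual.bsdp_of_padicVal_printShape_rankZero`. At a good ordinary `p` with
SURJECTIVE `ρ̄_{E,p}` this is also `Rank1Residual.bsdp_rankZero_of_S30` (Skinner–Urban Thm. 2 (a)).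
[cite: Skinner2016PacificMC, Thm. C (p. 173)] -/
theorem bsdp_rankZero_of_Skinner2016 (hSk : Skinner2016_padicValRat_bsd_rank_zero)
    (hmod : hasEntireLFunction_rat) (hGZK : rank_eq_analyticRank_of_analyticRank_le_one)
    (W : WeierstrassCurve ℚ) [W.IsElliptic] [W.IsGloballyMinimal] (p : ℕ) [Fact p.Prime]
    (hp : 3 ≤ p) (hred : Rank1Residual.GoodOrd W p ∨ W.HasMultiplicativeReductionAtPrime p)
    (hirr : W.HasIrreducibleModPGaloisRep p)
    (hram : ∃ q : ℕ, ∃ _ : Fact q.Prime, q ≠ p ∧ W.HasMultiplicativeReductionAtPrime q ∧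
      ¬ p ∣ padicValInt q W.minimalDiscriminantInt)
    (hr : W.analyticRank = 0) : BSDp W p := by
  have hfin : Finite W.sha := (hGZK W (by omega)).2
  have hL : W.entireLFunction 1 ≠ 0 := by
    rw [← W.leadingLCoeff_eq_of_analyticRank_eq_zero hr]
    exact W.leadingLCoeff_ne_zero_holds (hmod W)
  have hred' : (W.HasGoodReductionAtPrime p ∧ ¬ (p : ℤ) ∣ W.frobeniusTrace p) ∨
      W.HasMultiplicativeReductionAtPrime p :=
    hred.imp_left fun h ↦ ⟨h.1, h.2⟩
  exact Rank1Residual.bsdp_of_padicVal_printShape_rankZero W p hGZK hr hirr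
    (hSk W p hp hred' hirr hram hL hfin)

/-! ### The transfer theorem: analytic rank `0` at proportion `c` ⇒ full BSD off `S_ss` at proportion `c` -/

/-- **Full BSD off `S_ss(E)` for at least the analytic-rank-`0` proportion of curves (row (ii-3a) of
`PERCENT-FULL.md`, typed; (F1) and (F3) discharged).** If a proportion `≥ c` of the curves `E_{A,B}/ℚ`,
ordered by naive height, have `ord_{s=1} L(E,s) = 0`, then — given the named facts Duke 1997 Thm. 1,
Skinner 2016 Thm. C, modularity and Gross–Zagier–Kolyvagin, all published — a proportion `≥ c` have
analytic rank `0`, satisfy the rank part of BSD (`rk E(ℚ) = 0`, `Ш` finite: `SatisfiesBSDRankLeOne`),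
AND satisfy `BSD(E,p)` at EVERY prime `p ≥ 5` of good ordinary or multiplicative reduction — no
exceptional set. Proof: intersect with the density-one sets of (F1)
(`heightDensityGE_forall_surj_of_duke`) and (F3) (`heightDensityGE_twoOrdOnePrimes_one`), then pointwise
`bsdp_rankZero_of_Skinner2016` on the minimal model `W = C • E_{A,B}`: `r_an(W) = 0` by isomorphism
invariance, `E[p]` irreducible from surjectivity, and an auxiliary multiplicative `q ≠ p` with
`v_q(Δ_min) = 1` among the two exact primes of (F3), multiplicative by the Lemma-17 criterion and of
minimal-discriminant valuation `1` by (T) `padicValInt_minimalDiscriminantInt_smul_shortWeierstrass`.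
[cite: Skinner2016PacificMC, Thm. C (p. 173)] [cite: BhargavaSkinnerZhang2014, Cor. 22 and Lemma 20 (proof)]
[cite: Duke1997, Thm. 1 (p. 815)] -/
theorem HeightDensityGE.analyticRankZero_and_fullBSDOffSsPrime_of_sieve
    (hD : Duke1997_exceptionalPrimes_densityZero) (hSk : Skinner2016_padicValRat_bsd_rank_zero)
    (hmod : hasEntireLFunction_rat) (hGZK : rank_eq_analyticRank_of_analyticRank_le_one)
    {c : ℝ} (hA0 : HeightDensityGE AnalyticRankZero c) :
    HeightDensityGE
      (fun AB ↦ AnalyticRankZero AB ∧ SatisfiesBSDRankLeOne AB ∧ FullBSDOffSsPrime AB) c := by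
  have h3 := (hA0.and_of_one (heightDensityGE_forall_surj_of_duke hD)).and_of_one
    heightDensityGE_twoOrdOnePrimes_one
  refine BhargavaSkinnerZhang2014.HeightDensityGE.mono ?_ h3
  rintro AB ⟨⟨⟨hfam, hr0⟩, hS⟩, hM⟩
  haveI := isElliptic_shortWeierstrass hfam
  -- the rank part in analytic rank `0`, from Gross–Zagier–Kolyvagin
  have hGZ := hGZK (shortWeierstrass AB) (by omega)
  refine ⟨⟨hfam, hr0⟩, ⟨hfam, hGZ.1, by omega, hGZ.2⟩, ?_⟩
  intro W _ _ C hW p _ hp hred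
  have hpP : p.Prime := Fact.out
  -- analytic rank of the minimal model `W = C • E_{A,B}`
  have hr : W.analyticRank = 0 := by
    have e : (C • shortWeierstrass AB).analyticRank = (shortWeierstrass AB).analyticRank :=
      analyticRank_variableChange_holds (shortWeierstrass AB) C
    rw [← hW, e, hr0]
  -- irreducibility from surjectivity (F1)
  have hirr : W.HasIrreducibleModPGaloisRep p :=
    hasIrreducibleModPGaloisRep_of_hasSurjectiveModNGaloisRep W p (hS W C hW p)
  -- two distinct multiplicative primes with `v_ℓ(Δ_min) = 1`, from (F3) and (T); one of them is `≠ p`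
  obtain ⟨ℓ₁, ℓ₂, hℓ₁, hℓ₂, h5₁, h5₂, hne, hv₁, hv₂⟩ := hM
  haveI i₁ : Fact ℓ₁.Prime := ⟨hℓ₁⟩
  haveI i₂ : Fact ℓ₂.Prime := ⟨hℓ₂⟩
  have hm₁ : W.HasMultiplicativeReductionAtPrime ℓ₁ :=
    hW ▸ hasMultiplicativeReductionAtPrime_smul_shortWeierstrass_of_padicValInt_eq_one hfam C h5₁ hv₁
  have hm₂ : W.HasMultiplicativeReductionAtPrime ℓ₂ :=
    hW ▸ hasMultiplicativeReductionAtPrime_smul_shortWeierstrass_of_padicValInt_eq_one hfam C h5₂ hv₂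
  have hw₁ : ¬ p ∣ padicValInt ℓ₁ W.minimalDiscriminantInt := by
    rw [padicValInt_minimalDiscriminantInt_smul_shortWeierstrass hfam W C hW h5₁, hv₁]
    exact hpP.not_dvd_one
  have hw₂ : ¬ p ∣ padicValInt ℓ₂ W.minimalDiscriminantInt := by
    rw [padicValInt_minimalDiscriminantInt_smul_shortWeierstrass hfam W C hW h5₂, hv₂]
    exact hpP.not_dvd_one
  have hram : ∃ q : ℕ, ∃ _ : Fact q.Prime, q ≠ p ∧ W.HasMultiplicativeReductionAtPrime q ∧
      ¬ p ∣ padicValInt q W.minimalDiscriminantInt := by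
    by_cases h : ℓ₁ = p
    · exact ⟨ℓ₂, i₂, fun h' ↦ hne (h.trans h'.symm), hm₂, hw₂⟩
    · exact ⟨ℓ₁, i₁, h, hm₁, hw₁⟩
  exact bsdp_rankZero_of_Skinner2016 hSk hmod hGZK W p (by omega) hred hirr hram hr

/-- **Row (ii-3a) of `PERCENT-FULL.md` at `c⁰ = 17190625 / 104166656 = 0.165030…`** (the printed
constant `.16503` of Bhargava–Skinner–Zhang Cor. 22 times the family normaliser `(1 − 5⁻¹⁰)⁻¹` of the
`pub-bsdpct` bundle's audited densities; its inputs — the Bhargava–Shankar `5`-Selmer average,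
root-number equidistribution, the `p = 5` converse — are not in this tree, so the analytic-rank-`0`
proportion enters as the hypothesis `hA0`): IF a proportion `≥ c⁰` has analytic rank `0`, then a
proportion `≥ c⁰` has analytic rank `0`, satisfies the rank part of BSD, and satisfies `BSD(E,p)` at
every prime `p ≥ 5` of good ordinary or multiplicative reduction; everything else named is a
published theorem (Duke 1997; Skinner 2016 Thm. C; modularity; Gross–Zagier–Kolyvagin).
[cite: BhargavaSkinnerZhang2014, Cor. 22 (p. 10)] [cite: Skinner2016PacificMC, Thm. C (p. 173)] -/
theorem heightDensityGE_analyticRankZero_and_fullBSDOffSsPrime_c0_of_sieve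
    (hA0 : HeightDensityGE AnalyticRankZero (17190625 / 104166656))
    (hD : Duke1997_exceptionalPrimes_densityZero) (hSk : Skinner2016_padicValRat_bsd_rank_zero)
    (hmod : hasEntireLFunction_rat) (hGZK : rank_eq_analyticRank_of_analyticRank_le_one) :
    HeightDensityGE
      (fun AB ↦ AnalyticRankZero AB ∧ SatisfiesBSDRankLeOne AB ∧ FullBSDOffSsPrime AB)
      (17190625 / 104166656) :=
  HeightDensityGE.analyticRankZero_and_fullBSDOffSsPrime_of_sieve hD hSk hmod hGZK hA0

/-- **Row (ii-3a) in the predicates of rows (ii-1)/(ii-2)**: the same proportion satisfies the rank part,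
`FullBSDOffSgoPrime` and `FullBSDOffSmPrime` (the rank-`0` statement is the stronger one: no `Z*(E)`,
no `M*(E)`). [cite: BhargavaSkinnerZhang2014, Cor. 22 (p. 10)] -/
theorem HeightDensityGE.analyticRankZero_and_fullBSDOffSgoPrime_and_fullBSDOffSmPrime_of_sieve
    (hD : Duke1997_exceptionalPrimes_densityZero) (hSk : Skinner2016_padicValRat_bsd_rank_zero)
    (hmod : hasEntireLFunction_rat) (hGZK : rank_eq_analyticRank_of_analyticRank_le_one)
    {c : ℝ} (hA0 : HeightDensityGE AnalyticRankZero c) :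
    HeightDensityGE
      (fun AB ↦ AnalyticRankZero AB ∧ SatisfiesBSDRankLeOne AB ∧ FullBSDOffSgoPrime AB ∧
        FullBSDOffSmPrime AB) c := by
  refine BhargavaSkinnerZhang2014.HeightDensityGE.mono ?_
    (HeightDensityGE.analyticRankZero_and_fullBSDOffSsPrime_of_sieve hD hSk hmod hGZK hA0)
  rintro AB ⟨h0, hR, hS⟩
  exact ⟨h0, hR, hS.fullBSDOffSgoPrime, hS.fullBSDOffSmPrime⟩

end Literature.NumberTheory.EllipticCurves

end
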